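import Summits.Ventures.CertifiedManyBodySolver.Observables.StiffnessApexTransportMottStation
import Summits.Ventures.CertifiedManyBodySolver.Observables.StiffnessApexTransportFanTwoSided
import Summits.Ventures.CertifiedManyBodySolver.Observables.StiffnessApexTransportFanDoped
import HarnessLib

/-!
# Ventures/CertifiedManyBodySolver — Observables/StiffnessApexTransportMirrorFanWitness.lean

HONEST FRAMING: one-sided certified CEILINGS on the uniform flux stiffness (t–t′ f-sum class) at HALF FILLING (`n = 1`, Mott CONTROL/CALIBRATION line;
`ρ_s = 0` there in print is NOT a theorem here) at targets with `t′ > 0`, from the tree's `t′ < 0` SOURCES (fan stations) through a particle–hole-MIRRORED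
source WITNESS — along EVERY sequence of torus sides at the target (the g0/g1/g3 mirror words of this seat were even-sides `ObsStiffnessSeqCeilingOnMultiples 2`
dictionary entries, because they mirrored the TARGET). Every leaf is conditional on the rows / claim nodes it names; a ceiling never speaks to the presence of order;
not a `T_c` / superconductivity verdict; no number of record. Zero compute, no definition, no claim node, no `sorry`.

Cell `pub/hubbard-fast` (D-0154 (1)(A) «CERTIFICATE REUSE along parameter paths»), seat `hubbard-fast-reuse-2` g5 (`prover-hubbard-fast-reuse-2-g5-0`), path family
«APEX TRANSPORT», line «PH-SIGNED MOTT STATION», device «MIRROR-FAN WITNESS». Companion of `Observables/StiffnessApexTransportMottStation.lean` (p663186).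

THE POINT. The apex row needs ONE source state. A universal hopping floor `ℓ ≤ e_{Φ(1,κ′,0)}` on the half-filled class `(s, U₀, 1)` (e.g. a fan station's own f-sum
word moved along `κ′ ≥ 2s` by the half-filling sign `s·K₂ ≤ 0`) becomes, under the particle–hole map of ONE torus-limit ground state chosen along even sides,
the floor `ℓ ≤ e_{Φ(1,−κ′,0)}(ω ∘ α)` of a WITNESS in the mirrored class `(−s, U₀, 1)` (`K₁` invariant, `K₂ ↦ −K₂`) — §1. At the TARGET `(t′_P, U_P, 1)` the sign
`t′_P·K₂ ≤ 0` holds for EVERY torus-limit ground state (`IsTorusLimitOf.tPrime_mul_diagHopEnergy_nonpos_of_groundState_halfFilling`, a variational fact, no parity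
condition), so a single witness floor at the apex hopping `κ₁` with `t′_P(κ₁ − 2t′_P) ≥ 0` already floors the f-sum functional at `2t′_P` — §2. Hence every
`t′ < 0` fan word of the tree has an all-sides twin at `t′ > 0`: §3 is the `t′ ↦ −t′` image of unc-2's two-sided fan engine
(`ObsStiffnessSeqCeilingAt_halfFilling_on_apexTwoSidedFan_of_fsumRow` / `…_on_rect_of_fsumRow_kinematicTarget`) with the source witness in place of
the first existence call — same constants, every sequence of sides.

* §1 `exists_torusLimit_halfFilling_mirror_hoppingFloor` (the mirrored witness);
* §2 `ObsStiffnessSeqCeilingAt_halfFilling_of_sourceWitness_targetSign` (one witness floor at the apex hopping + the target's sign, either sign of `t′_P ≠ 0`);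
* §3 `ObsStiffnessSeqCeilingAt_halfFilling_on_mirrorTwoSidedFan_of_fsumRow` (source `t′_A < 0` row + source `K₂` ceiling + target `K₂` floor ⇒ target `t′_P > 0`,
  hinges `max(2t′_A + κ, 0)·A/4 + max(2t′_P − κ, 0)·A_P/4`), `…_kinematicTarget` (`A_P = 1.6211390`), `…_on_mirrorRect_…` (box `[t₁, t₂] × [U₁, U₂]`, `0 < t₁`,
  by ONE corner inequality) and `…_on_mirrorRectIoc_…` (box `(0, t₂] × [U₁, U₂]`).

NOT said: nothing flows toward `U_P ≤ U_A`; the witness trick is a HALF-FILLING fact; `λ ≠ 0` words are not of this form; no `T > 0`; `ρ_s = 0` on the Mott line is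
print, not a theorem here; no number in this file.

References: T. Koma, H. Tasaki, J. Stat. Phys. 76 (1994) 745, §1 [KomaTasaki1994]; E. H. Lieb, F. Y. Wu, Physica A 321 (2003) 1, §1 eq. (3) [LiebWuPhysicaA2003];
E. H. Lieb, PRL 62 (1989) 1201, Theorem 2 [LiebPRL1989]; D. J. Scalapino, S. R. White, S.-C. Zhang, PRB 47 (1993) 7995, §II [ScalapinoWhiteZhang1993];
T. Hazra, N. Verma, M. Randeria, PRX 9 (2019) 031049, eq. (4) [HazraVermaRanderia2019].
-/

noncomputable section

namespace Summit.Ventures.CertifiedManyBodySolver.Observables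

open Literature.MathematicalPhysics.QuantumLattice
open Literature.MathematicalPhysics.QuantumLattice.ThermodynamicLimit
open Literature.MathematicalPhysics.QuantumFieldTheory
open Literature.Probability.LatticeModels
open Matrix Finset Filter Topology HubbardWave0
open scoped Matrix BigOperators ComplexOrder

/-! ## §1 The mirrored witness: a universal hopping floor at `κ′` on `(s, U₀, 1)` is a witness floor at `−κ′` on `(−s, U₀, 1)` -/

section Witness

variable {s U₀ : ℝ}

/-- **MIRROR WITNESS (half filling).** If `ℓ ≤ e_{Φ(1,κ′,0)}(ω)` for every torus limit `ω` of unit `(rectN 1 L, S^z = 0)`-sector ground states of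
`hubbardTorusTT' L 1 s U₀`, then there is a torus limit `ω⋆` of unit `(rectN 1 L, S^z = 0)`-sector ground states of `hubbardTorusTT' L 1 (−s) U₀` (along sides
`2·φ(j) → ∞`) with `ℓ ≤ e_{Φ(1,−κ′,0)}(ω⋆)`: `ω⋆ = ω ∘ α` for a ground state `ω` of the `s`-class along even sides
(`IsTorusLimitOf.particleHole_of_sectorGroundStates` at `n = 1`), `K₁(ω ∘ α) = K₁(ω)`, `K₂(ω ∘ α) = −K₂(ω)`, so `e_{Φ(1,−κ′,0)}(ω ∘ α) = e_{Φ(1,κ′,0)}(ω)`.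
[cite: LiebWuPhysicaA2003, §1 eq. (3)] [cite: LiebPRL1989, Theorem 2 (bipartite lattice)] -/
theorem exists_torusLimit_halfFilling_mirror_hoppingFloor (κ' : ℝ) {ℓ : ℝ}
    (h : ∀ (ω : InfVolFermionState 2) (Ls : ℕ → ℕ) (ψ : ∀ L, Fock (Orb (FermionTorus 2 L))),
      Tendsto Ls atTop atTop →
      (∀ j, IsGroundStateInSector (hubbardTorusTT' (Ls j) 1 s U₀) (rectN 1 (Ls j)) 0 (ψ (Ls j))) →
      (∀ j, star (ψ (Ls j)) ⬝ᵥ ψ (Ls j) = 1) → ω.IsTorusLimitOf ψ Ls →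
      ℓ ≤ ω.meanEnergy (hubbardTTPrimeFermionInteraction 1 κ' 0) 1) :
    ∃ (ω : InfVolFermionState 2) (Ls : ℕ → ℕ) (ψ : ∀ L, Fock (Orb (FermionTorus 2 L))),
      Tendsto Ls atTop atTop ∧
      (∀ j, IsGroundStateInSector (hubbardTorusTT' (Ls j) 1 (-s) U₀) (rectN 1 (Ls j)) 0 (ψ (Ls j))) ∧
      (∀ j, star (ψ (Ls j)) ⬝ᵥ ψ (Ls j) = 1) ∧ ω.IsTorusLimitOf ψ Ls ∧
      ℓ ≤ ω.meanEnergy (hubbardTTPrimeFermionInteraction 1 (-κ') 0) 1 := by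
  classical
  have h2 : Tendsto (fun j : ℕ => 2 * j) atTop atTop :=
    tendsto_atTop_mono (fun j => Nat.le_mul_of_pos_left j (by norm_num)) tendsto_id
  obtain ⟨ψ, φ, ω, hφ, hψ, hψ1, hω, -, -, -⟩ :=
    exists_isTorusLimitOf_sectorGroundState_TT' 1 s U₀ (n := 1) zero_le_one one_le_two (Ls := fun j : ℕ => 2 * j) h2
  set Ls : ℕ → ℕ := (fun j : ℕ => 2 * j) ∘ φ with hLs_def
  have hLs : Tendsto Ls atTop atTop := h2.comp hφ.tendsto_atTop
  have hψL : ∀ j, IsGroundStateInSector (hubbardTorusTT' (Ls j) 1 s U₀) (rectN 1 (Ls j)) 0 (ψ (Ls j)) := fun j => hψ _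
  have h1L : ∀ j, star (ψ (Ls j)) ⬝ᵥ ψ (Ls j) = 1 := fun j => hψ1 _
  have hN : ∀ j, IsNParticle (rectN 1 (Ls j)) (ψ (Ls j)) := fun j => ((mem_szSector_iff _ _ _).1 (hψL j).1).1
  have hℓ := h ω Ls ψ hLs hψL h1L hω
  have heven : ∀ᶠ j in atTop, Even (Ls j) := Eventually.of_forall fun j => by
    simp only [hLs_def, Function.comp_apply]; exact even_two_mul _
  have hadd : ∀ᶠ j in atTop, halfRectN (2 - 1) (Ls j) + halfRectN 1 (Ls j) = Ls j ^ 2 :=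
    Eventually.of_forall fun j => halfRectN_two_sub_add_of_eq (n := 1) one_le_two (m := 2 * φ j ^ 2) (by
      simp only [hLs_def, Function.comp_apply]; push_cast; ring)
  obtain ⟨ψ', hψ', h1', hω'⟩ :=
    hω.particleHole_of_sectorGroundStates 1 s U₀ (n := 1) zero_le_one one_le_two heven hadd hψL h1L
  have hK₁' := hω.meanEnergy_kineticWord_particleHole hLs hN h1L heven
  have hK₂' := hω.meanEnergy_diagHopWord_particleHole hLs hN h1L heven
  have eκ := ω.meanEnergy_hubbardTTPrime_eq_coords 1 κ' 0
  have eκ' := ω.particleHole.meanEnergy_hubbardTTPrime_eq_coords 1 (-κ') 0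
  refine ⟨ω.particleHole, Ls, ψ', hLs, fun j => ?_, fun j => h1' _, hω', ?_⟩
  · have hj := hψ' (Ls j)
    rw [show (2 : ℝ) - 1 = 1 by norm_num] at hj
    exact hj
  · rw [eκ', hK₁', hK₂']
    rw [eκ] at hℓ
    linarith

end Witness

/-! ## §2 One witness floor at the apex hopping + the TARGET's half-filling sign `t′·K₂ ≤ 0` -/

section TargetSign

variable {t'P UP s₁ U₁ : ℝ}

/-- **WITNESS SOURCE × TARGET SIGN (half filling).** Target `(t′_P, U_P, 1)`, `U_P ≥ 0`; one source class `(s₁, U₁, 1)`, `0 ≤ U₁ < U_P`, with a WITNESS `ω₁` (torus-limit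
ground state along some `Ls → ∞`) carrying `ℓ₁ ≤ e_{Φ(1,κ₁,0)}(ω₁)` at the apex hopping `κ₁ = (U_P s₁ − U₁ t′_P)/(U_P − U₁)`; orientation `t′_P·(κ₁ − 2t′_P) ≥ 0`
and `t′_P ≠ 0` (the target hopping `2t′_P` lies on the side of `κ₁` toward which the target's one-body energy decreases: `e_{Φ(1,2t′_P,0)} = e_{Φ(1,κ₁,0)} + (2t′_P − κ₁)K₂ ≥ e_{Φ(1,κ₁,0)}`
by `t′_P·K₂ ≤ 0` on EVERY torus-limit ground state of the half-filled target class). Then `ObsStiffnessSeqCeilingAt t′_P U_P 1 c` for every rational `c ≥ −ℓ₁/4`.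
[cite: KomaTasaki1994, §1] [cite: ScalapinoWhiteZhang1993, §II] [cite: HazraVermaRanderia2019, eq. (4)] -/
theorem ObsStiffnessSeqCeilingAt_halfFilling_of_sourceWitness_targetSign (hU₁0 : 0 ≤ U₁) (hU₁ : U₁ < UP) (ht : t'P ≠ 0)
    (hor : 0 ≤ t'P * ((UP * s₁ - U₁ * t'P) / (UP - U₁) - 2 * t'P)) {ℓ₁ : ℝ}
    (h₁ : ∃ (ω : InfVolFermionState 2) (Ls : ℕ → ℕ) (ψ : ∀ L, Fock (Orb (FermionTorus 2 L))),
      Tendsto Ls atTop atTop ∧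
      (∀ j, IsGroundStateInSector (hubbardTorusTT' (Ls j) 1 s₁ U₁) (rectN 1 (Ls j)) 0 (ψ (Ls j))) ∧
      (∀ j, star (ψ (Ls j)) ⬝ᵥ ψ (Ls j) = 1) ∧ ω.IsTorusLimitOf ψ Ls ∧
      ℓ₁ ≤ ω.meanEnergy (hubbardTTPrimeFermionInteraction 1 ((UP * s₁ - U₁ * t'P) / (UP - U₁)) 0) 1)
    (c : ℚ) (hc : -ℓ₁ / 4 ≤ ((c : ℚ) : ℝ)) :
    ObsStiffnessSeqCeilingAt t'P UP 1 c := by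
  intro ρs θ₀ _ hθ₀ Ls hLs hst
  refine fluxStiffness_le_of_torusLimitTT'_oddMoment_orbit_certificate_seq t'P (U := UP) (δ := 1 - 1) (q := ((c : ℚ) : ℝ)) 0
    Finset.univ Finset.univ_nonempty (by linarith) (by linarith) hθ₀ hLs hst ?_
  intro ω Ms ψ hMs hψ h1 hω
  have hψ' : ∀ j, IsGroundStateInSector (hubbardTorusTT' (Ms j) 1 t'P UP) (rectN 1 (Ms j)) 0 (ψ (Ms j)) := fun j => by
    simpa only [sub_self, sub_zero] using hψ j
  rw [orbitMean_rotOddMomentLimitFunctionalTT_lam_zero_eq_meanEnergy_twice_tPrime hω.isTranslationInvariant]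
  obtain ⟨ω₁, L₁, φ₁, hL₁, hφ₁, hφ₁1, hω₁, hl₁⟩ := h₁
  have hapx₁ := InfVolFermionState.IsTorusLimitOf.meanEnergy_apexHopping_le_of_groundStates 1 s₁ t'P hU₁0 hU₁ zero_le_one one_lt_two
    hω₁ hL₁ hφ₁ hφ₁1 hω hMs hψ' h1
  -- the target's half-filling sign `t′_P·K₂(ω) ≤ 0`
  have hsgn := InfVolFermionState.IsTorusLimitOf.tPrime_mul_diagHopEnergy_nonpos_of_groundState_halfFilling 1 t'P (hU₁0.trans hU₁.le)
    hω hMs hψ' h1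
  set κ₁ : ℝ := (UP * s₁ - U₁ * t'P) / (UP - U₁) with hκ₁
  have e₁ := ω.meanEnergy_hubbardTTPrime_eq_coords 1 κ₁ 0
  have eP := ω.meanEnergy_hubbardTTPrime_eq_coords 1 (2 * t'P) 0
  have hc' : -ℓ₁ / 4 ≤ ((c : ℚ) : ℝ) := hc
  -- e(2t′) − e(κ₁) = (2t′ − κ₁)·K₂ ≥ 0
  have hmove : ω.meanEnergy (hubbardTTPrimeFermionInteraction 1 κ₁ 0) 1 ≤
      ω.meanEnergy (hubbardTTPrimeFermionInteraction 1 (2 * t'P) 0) 1 := by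
    set K₂ := ω.meanEnergy (hubbardTTPrimeFermionInteraction 0 1 0) 1 with hK₂
    have ht2 : 0 < t'P ^ 2 := by positivity
    have hprod : t'P ^ 2 * ((κ₁ - 2 * t'P) * K₂) ≤ 0 := by
      have := mul_nonpos_of_nonpos_of_nonneg hsgn hor
      nlinarith [this]
    have hkey : (κ₁ - 2 * t'P) * K₂ ≤ 0 := by
      by_contra hneg
      have hpos : 0 < (κ₁ - 2 * t'P) * K₂ := lt_of_not_ge hneg
      nlinarith [mul_pos ht2 hpos]
    rw [e₁, eP]
    nlinarith [hkey]
  linarith [hl₁.trans hapx₁]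

end TargetSign

/-! ## §3 The MIRRORED two-sided fan: a `t′ < 0` source row words targets with `t′ > 0` along every sequence of sides -/

section MirrorFan

variable {t'A UA : ℝ}

/-- **THE MIRRORED TWO-SIDED FAN (half filling; source `t′_A < 0`, target `t′_P > 0`).** A certified f-sum orbit row `r` at the source `(t′_A, U_A, 1)`
(`U_A ≥ 0`, cap certified), a ceiling `K₂ ≤ A` (`A ≥ 0`) on the source class and a FLOOR `−A_P ≤ K₂` (`A_P ≥ 0`, e.g. the kinematic `1.6211390`) on the TARGET class
`(t′_P, U_P, 1)` give, for EVERY target with `U_A < U_P` and `t′_P > 0`, `ObsStiffnessSeqCeilingAt t′_P U_P 1 c` — along EVERY sequence of torus sides — for every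
`c ≥ −r + max(2t′_A + κ, 0)·A/4 + max(2t′_P − κ, 0)·A_P/4`, `κ = (U_P(−t′_A) − U_A t′_P)/(U_P − U_A)` = the apex hopping of the line target → `(−t′_A, U_A)`.
MECHANISM: one torus-limit ground state `ω_A` of the source class along EVEN sides carries the source row and hinge (`K₂(ω_A) ∈ [0, A]` by the half-filling sign);
its particle–hole twin `ω_A ∘ α` is a torus-limit ground state of the MIRROR class `(−t′_A, U_A, 1)` with `e_{Φ(1,κ,0)}(ω_A ∘ α) = e_{Φ(1,−κ,0)}(ω_A)`; the apex row
compares that ONE state with the target state; the target hinge uses `t′_P·K₂ ≤ 0` (every ground state, no parity) and the floor `−A_P`. This is the g0/g1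
mirror-twin word (`ObsStiffnessSeqCeilingOnMultiples 2`, which mirrored the TARGET) with the parity moved to the freely chosen SOURCE witness: same constant,
all sides. [cite: KomaTasaki1994, §1] [cite: ScalapinoWhiteZhang1993, §II] [cite: LiebWuPhysicaA2003, §1 eq. (3)] -/
theorem ObsStiffnessSeqCeilingAt_halfFilling_on_mirrorTwoSidedFan_of_fsumRow (Uo : ℝ) (hUA : 0 ≤ UA) (ht'A : t'A < 0) {u r : ℚ}
    (hrow : SquareTTPrimeCorrOrbitLowerRow t'A UA 1 u r Finset.univ (box 2 7) (-oddMomentObsTT t'A Uo 0))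
    (hu : energyDensityTT' 1 t'A UA 1 ≤ ((u : ℚ) : ℝ)) {A : ℝ} (hA0 : 0 ≤ A)
    (hA : ∀ (ω : InfVolFermionState 2) (Ls : ℕ → ℕ) (ψ : ∀ L, Fock (Orb (FermionTorus 2 L))),
      Tendsto Ls atTop atTop →
      (∀ j, IsGroundStateInSector (hubbardTorusTT' (Ls j) 1 t'A UA) (rectN 1 (Ls j)) 0 (ψ (Ls j))) →
      (∀ j, star (ψ (Ls j)) ⬝ᵥ ψ (Ls j) = 1) → ω.IsTorusLimitOf ψ Ls →
      ω.meanEnergy (hubbardTTPrimeFermionInteraction 0 1 0) 1 ≤ A)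
    {t'P UP : ℝ} {AP : ℝ} (hAP0 : 0 ≤ AP)
    (hAP : ∀ (ω : InfVolFermionState 2) (Ls : ℕ → ℕ) (ψ : ∀ L, Fock (Orb (FermionTorus 2 L))),
      Tendsto Ls atTop atTop →
      (∀ j, IsGroundStateInSector (hubbardTorusTT' (Ls j) 1 t'P UP) (rectN 1 (Ls j)) 0 (ψ (Ls j))) →
      (∀ j, star (ψ (Ls j)) ⬝ᵥ ψ (Ls j) = 1) → ω.IsTorusLimitOf ψ Ls →
      -AP ≤ ω.meanEnergy (hubbardTTPrimeFermionInteraction 0 1 0) 1)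
    (hU : UA < UP) (ht'P : 0 < t'P) (c : ℚ)
    (hc : -((r : ℚ) : ℝ) + max (2 * t'A + (UP * (-t'A) - UA * t'P) / (UP - UA)) 0 * A / 4 +
      max (2 * t'P - (UP * (-t'A) - UA * t'P) / (UP - UA)) 0 * AP / 4 ≤ ((c : ℚ) : ℝ)) :
    ObsStiffnessSeqCeilingAt t'P UP 1 c := by
  classical
  have hd : 0 < UP - UA := sub_pos.2 hU
  set κ : ℝ := (UP * (-t'A) - UA * t'P) / (UP - UA) with hκ_def
  have hmA : 0 ≤ max (2 * t'A + κ) 0 * A / 4 := div_nonneg (mul_nonneg (le_max_right _ _) hA0) (by norm_num)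
  have hmP : 0 ≤ max (2 * t'P - κ) 0 * AP / 4 := div_nonneg (mul_nonneg (le_max_right _ _) hAP0) (by norm_num)
  intro ρs θ₀ _ hθ₀ Ls hLs hst
  refine (fluxStiffness_le_of_torusLimitTT'_oddMoment_orbit_certificate_seq t'P (U := UP) (δ := 1 - 1) (q := ((c : ℚ) : ℝ)) 0
    Finset.univ Finset.univ_nonempty (by norm_num) (by norm_num) hθ₀ hLs hst ?_)
  intro ω Ms ψ hMs hψ h1 hω
  have hψ' : ∀ j, IsGroundStateInSector (hubbardTorusTT' (Ms j) 1 t'P UP) (rectN 1 (Ms j)) 0 (ψ (Ms j)) := fun j => by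
    simpa only [sub_sub_cancel] using hψ j
  rw [orbitMean_rotOddMomentLimitFunctionalTT_lam_zero_eq_meanEnergy_twice_tPrime hω.isTranslationInvariant]
  -- ONE source ground state along EVEN sides, and its particle–hole twin in the mirror class
  have h2 : Tendsto (fun j : ℕ => 2 * j) atTop atTop :=
    tendsto_atTop_mono (fun j => Nat.le_mul_of_pos_left j (by norm_num)) tendsto_id
  obtain ⟨ψA, φ, ωA, hφ, hψA, hψA1, hωA, -, -, -⟩ :=
    exists_isTorusLimitOf_sectorGroundState_TT' 1 t'A UA (n := 1) zero_le_one one_le_two (Ls := fun j : ℕ => 2 * j) h2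
  set LA : ℕ → ℕ := (fun j : ℕ => 2 * j) ∘ φ with hLA_def
  have hLA : Tendsto LA atTop atTop := h2.comp hφ.tendsto_atTop
  have hψAL : ∀ j, IsGroundStateInSector (hubbardTorusTT' (LA j) 1 t'A UA) (rectN 1 (LA j)) 0 (ψA (LA j)) := fun j => hψA _
  have h1AL : ∀ j, star (ψA (LA j)) ⬝ᵥ ψA (LA j) = 1 := fun j => hψA1 _
  have hNA : ∀ j, IsNParticle (rectN 1 (LA j)) (ψA (LA j)) := fun j => ((mem_szSector_iff _ _ _).1 (hψAL j).1).1
  have heven : ∀ᶠ j in atTop, Even (LA j) := Eventually.of_forall fun j => by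
    simp only [hLA_def, Function.comp_apply]; exact even_two_mul _
  have hadd : ∀ᶠ j in atTop, halfRectN (2 - 1) (LA j) + halfRectN 1 (LA j) = LA j ^ 2 :=
    Eventually.of_forall fun j => halfRectN_two_sub_add_of_eq (n := 1) one_le_two (m := 2 * φ j ^ 2) (by
      simp only [hLA_def, Function.comp_apply]; push_cast; ring)
  obtain ⟨ψ', hψ'₀, h1', hω'⟩ :=
    hωA.particleHole_of_sectorGroundStates 1 t'A UA (n := 1) zero_le_one one_le_two heven hadd hψAL h1AL
  have hψ'' : ∀ j, IsGroundStateInSector (hubbardTorusTT' (LA j) 1 (-t'A) UA) (rectN 1 (LA j)) 0 (ψ' (LA j)) := fun j => by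
    have hj := hψ'₀ (LA j)
    rw [show (2 : ℝ) - 1 = 1 by norm_num] at hj
    exact hj
  have hK₁' := hωA.meanEnergy_kineticWord_particleHole hLA hNA h1AL heven
  have hK₂' := hωA.meanEnergy_diagHopWord_particleHole hLA hNA h1AL heven
  -- apex row between the TWIN (class `(−t′_A, U_A)`) and the target: `e_κ(ω_A ∘ α) ≤ e_κ(ω_P)`
  have hapx := InfVolFermionState.IsTorusLimitOf.meanEnergy_apexHopping_le_of_groundStates 1 (-t'A) t'P hUA hU zero_le_one
    one_lt_two hω' hLA hψ'' (fun j => h1' _) hω hMs hψ' h1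
  simp only [← hκ_def] at hapx
  -- the twin's word at `κ` IS the source's word at `−κ`
  have htwin : ωA.particleHole.meanEnergy (hubbardTTPrimeFermionInteraction 1 κ 0) 1 =
      ωA.meanEnergy (hubbardTTPrimeFermionInteraction 1 (-κ) 0) 1 := by
    rw [ωA.particleHole.meanEnergy_hubbardTTPrime_eq_coords 1 κ 0, ωA.meanEnergy_hubbardTTPrime_eq_coords 1 (-κ) 0, hK₁', hK₂']
    ring
  -- target end, hinge form (t′_P > 0: `K₂ ≤ 0` and `K₂ ≥ −A_P`): `e_κ(ω_P) ≤ e_{2t′_P}(ω_P) + max(2t′_P − κ, 0)·A_P`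
  have htgt : ω.meanEnergy (hubbardTTPrimeFermionInteraction 1 κ 0) 1 ≤
      ω.meanEnergy (hubbardTTPrimeFermionInteraction 1 (2 * t'P) 0) 1 + max (2 * t'P - κ) 0 * AP := by
    rcases le_total (2 * t'P) κ with hle | hge
    · -- κ ≥ 2t′_P: free move in the direction of t′
      have hcP : 0 ≤ (κ - 2 * t'P) / t'P := div_nonneg (by linarith) ht'P.le
      have heP : κ - 2 * t'P = (κ - 2 * t'P) / t'P * t'P := by rw [div_mul_cancel₀ _ ht'P.ne']
      have h := InfVolFermionState.IsTorusLimitOf.meanEnergy_oneBody_anti_hopping_of_groundState_halfFilling 1 t'P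
        (hUA.trans hU.le) hω hMs hψ' h1 (κ := 2 * t'P) (κ' := κ) hcP heP
      nlinarith [mul_nonneg (le_max_right (2 * t'P - κ) 0) hAP0]
    · -- κ ≤ 2t′_P: priced by the K₂ floor −A_P
      have h := InfVolFermionState.meanEnergy_hopping_add_mul_le_of_le_diagHop ω 1 (κ := κ) (κ' := 2 * t'P) hge
        (hAP ω Ms ψ hMs hψ' h1 hω)
      have hm : (2 * t'P - κ) * AP ≤ max (2 * t'P - κ) 0 * AP := mul_le_mul_of_nonneg_right (le_max_left _ _) hAP0
      nlinarith [hm, h]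
  -- source end, hinge form at `−κ` (on ω_A, a member of the `t′_A` class): `e_{2t′_A}(ω_A) ≤ e_{−κ}(ω_A) + max(2t′_A + κ, 0)·A`
  have hsrc : ωA.meanEnergy (hubbardTTPrimeFermionInteraction 1 (2 * t'A) 0) 1 ≤
      ωA.meanEnergy (hubbardTTPrimeFermionInteraction 1 (-κ) 0) 1 + max (2 * t'A + κ) 0 * A := by
    rcases le_total (-κ) (2 * t'A) with hle | hge
    · have h := InfVolFermionState.meanEnergy_hopping_le_add_mul_of_diagHop_le ωA 1 (κ := -κ) (κ' := 2 * t'A) hle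
        (hA ωA LA ψA hLA hψAL h1AL hωA)
      have hm : (2 * t'A - -κ) * A ≤ max (2 * t'A + κ) 0 * A :=
        mul_le_mul_of_nonneg_right (by rw [sub_neg_eq_add]; exact le_max_left _ _) hA0
      linarith
    · have hcA : 0 ≤ (2 * t'A - -κ) / t'A := div_nonneg_of_nonpos (by linarith) ht'A.le
      have heA : 2 * t'A - -κ = (2 * t'A - -κ) / t'A * t'A := by rw [div_mul_cancel₀ _ ht'A.ne]
      have h := InfVolFermionState.IsTorusLimitOf.meanEnergy_oneBody_anti_hopping_of_groundState_halfFilling 1 t'A hUA hωA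
        hLA hψAL h1AL (κ := -κ) (κ' := 2 * t'A) hcA heA
      nlinarith [mul_nonneg (le_max_right (2 * t'A + κ) 0) hA0]
  have hv := hrow ωA LA ψA hLA hψAL h1AL hωA hu
  rw [orbitMean_re_expect_neg_oddMomentTT_lam_zero hωA.isTranslationInvariant] at hv
  rw [htwin] at hapx
  linarith

/-- **Mirrored two-sided fan, KINEMATIC target floor** (`A_P = 1.6211390`, no word on the target class): every target with `U_A < U_P`, `t′_P > 0` and
`c ≥ −r + max(2t′_A + κ, 0)·A/4 + max(2t′_P − κ, 0)·1.6211390/4`, along every sequence of sides. [cite: KomaTasaki1994, §1] [cite: LiebLoss1993, §8, Theorem 8.2] -/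
theorem ObsStiffnessSeqCeilingAt_halfFilling_on_mirrorTwoSidedFan_of_fsumRow_kinematicTarget (Uo : ℝ) (hUA : 0 ≤ UA) (ht'A : t'A < 0)
    {u r : ℚ} (hrow : SquareTTPrimeCorrOrbitLowerRow t'A UA 1 u r Finset.univ (box 2 7) (-oddMomentObsTT t'A Uo 0))
    (hu : energyDensityTT' 1 t'A UA 1 ≤ ((u : ℚ) : ℝ)) {A : ℝ} (hA0 : 0 ≤ A)
    (hA : ∀ (ω : InfVolFermionState 2) (Ls : ℕ → ℕ) (ψ : ∀ L, Fock (Orb (FermionTorus 2 L))),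
      Tendsto Ls atTop atTop →
      (∀ j, IsGroundStateInSector (hubbardTorusTT' (Ls j) 1 t'A UA) (rectN 1 (Ls j)) 0 (ψ (Ls j))) →
      (∀ j, star (ψ (Ls j)) ⬝ᵥ ψ (Ls j) = 1) → ω.IsTorusLimitOf ψ Ls →
      ω.meanEnergy (hubbardTTPrimeFermionInteraction 0 1 0) 1 ≤ A)
    {t'P UP : ℝ} (hU : UA < UP) (ht'P : 0 < t'P) (c : ℚ)
    (hc : -((r : ℚ) : ℝ) + max (2 * t'A + (UP * (-t'A) - UA * t'P) / (UP - UA)) 0 * A / 4 +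
      max (2 * t'P - (UP * (-t'A) - UA * t'P) / (UP - UA)) 0 * 1.6211390 / 4 ≤ ((c : ℚ) : ℝ)) :
    ObsStiffnessSeqCeilingAt t'P UP 1 c :=
  ObsStiffnessSeqCeilingAt_halfFilling_on_mirrorTwoSidedFan_of_fsumRow Uo hUA ht'A hrow hu hA0 hA (by norm_num)
    (forall_torusLimit_kinematic_le_diagHop t'P UP zero_le_one one_lt_two) hU ht'P c hc

/-- **ONE CORNER WORDS A MIRROR RECTANGLE** (half filling; source `t′_A < 0`, decimal source words `−r ≤ w`, `A ≤ a`, kinematic target floor): for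
`[t₁, t₂] × [U₁, U₂]` with `0 < t₁`, `t₂ ≤ −t′_A`, `U_A < U₁` and `c ≥ w + max(2t′_A + κ(t₁, U₁), 0)·a/4 + max(2t₂ − κ(t₂, U₂), 0)·1.6211390/4`
(`κ(t, U) = (U(−t′_A) − U_A t)/(U − U_A)`; the source hinge is largest at `(t₁, U₁)`, the target hinge at `(t₂, U₂)`), `ObsStiffnessSeqCeilingAt tp U 1 c` at every point of
the rectangle — the `t′ ↦ −t′` image of `…halfFilling_on_rect_of_fsumRow_kinematicTarget`, along every sequence of sides. [cite: KomaTasaki1994, §1] [cite: ScalapinoWhiteZhang1993, §II] -/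
theorem ObsStiffnessSeqCeilingAt_halfFilling_on_mirrorRect_of_fsumRow_kinematicTarget (Uo : ℝ) (hUA : 0 ≤ UA) (ht'A : t'A < 0) {u r : ℚ}
    (hrow : SquareTTPrimeCorrOrbitLowerRow t'A UA 1 u r Finset.univ (box 2 7) (-oddMomentObsTT t'A Uo 0))
    (hu : energyDensityTT' 1 t'A UA 1 ≤ ((u : ℚ) : ℝ)) {A : ℝ} (hA0 : 0 ≤ A)
    (hA : ∀ (ω : InfVolFermionState 2) (Ls : ℕ → ℕ) (ψ : ∀ L, Fock (Orb (FermionTorus 2 L))),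
      Tendsto Ls atTop atTop →
      (∀ j, IsGroundStateInSector (hubbardTorusTT' (Ls j) 1 t'A UA) (rectN 1 (Ls j)) 0 (ψ (Ls j))) →
      (∀ j, star (ψ (Ls j)) ⬝ᵥ ψ (Ls j) = 1) → ω.IsTorusLimitOf ψ Ls →
      ω.meanEnergy (hubbardTTPrimeFermionInteraction 0 1 0) 1 ≤ A)
    {w a : ℝ} (hw : -((r : ℚ) : ℝ) ≤ w) (ha : A ≤ a) {t₁ t₂ U₁ U₂ : ℝ} (ht₁ : 0 < t₁) (ht₂ : t₂ ≤ -t'A) (hU₁ : UA < U₁) (c : ℚ)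
    (hc : w + max (2 * t'A + (U₁ * (-t'A) - UA * t₁) / (U₁ - UA)) 0 * a / 4 +
      max (2 * t₂ - (U₂ * (-t'A) - UA * t₂) / (U₂ - UA)) 0 * 1.6211390 / 4 ≤ ((c : ℚ) : ℝ)) :
    ∀ tp ∈ Set.Icc t₁ t₂, ∀ U ∈ Set.Icc U₁ U₂, ObsStiffnessSeqCeilingAt tp U 1 c := by
  intro tp htp U hU
  have ha0 : 0 ≤ a := hA0.trans ha
  refine ObsStiffnessSeqCeilingAt_halfFilling_on_mirrorTwoSidedFan_of_fsumRow_kinematicTarget Uo hUA ht'A hrow hu hA0 hA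
    (by linarith [hU.1]) (by linarith [htp.1]) c ?_
  -- κ(tp, U) with (−t′_A, −tp) in the role of (t′_A, tp) of the t′ < 0 corner lemmas
  have hneg : (0 : ℝ) ≤ UA := hUA
  have h₁ : max (2 * t'A + (U * (-t'A) - UA * tp) / (U - UA)) 0 ≤ max (2 * t'A + (U₁ * (-t'A) - UA * t₁) / (U₁ - UA)) 0 := by
    -- κ(tp,U) = −κ′(−tp,U) with κ′ the t′_A-fan hopping; κ′ is smallest at the corner (−t₁, U₁) ⇒ κ largest there... we need κ(tp,U) ≤ κ(t₁,U₁)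
    have hk : (U * t'A - UA * (-tp)) / (U - UA) ≥ (U₁ * t'A - UA * (-t₁)) / (U₁ - UA) :=
      apexFan_kappa_corner_le hUA hU₁ hU.1 (by linarith [htp.1]) (by linarith [htp.2, ht₂, htp.1])
    have e1 : (U * (-t'A) - UA * tp) / (U - UA) = -((U * t'A - UA * (-tp)) / (U - UA)) := by ring
    have e2 : (U₁ * (-t'A) - UA * t₁) / (U₁ - UA) = -((U₁ * t'A - UA * (-t₁)) / (U₁ - UA)) := by ring
    rw [e1, e2]
    exact max_le_max (by linarith) le_rfl
  have h₂ : max (2 * tp - (U * (-t'A) - UA * tp) / (U - UA)) 0 ≤ max (2 * t₂ - (U₂ * (-t'A) - UA * t₂) / (U₂ - UA)) 0 := by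
    have hk := apexFan_kappa_sub_corner_le (t'A := t'A) hUA (by linarith [hU.1]) hU.2 (t₁ := -t₂) (t := -tp) (by linarith [htp.2]) (by linarith [ht₂])
    have e1 : (U * (-t'A) - UA * tp) / (U - UA) = -((U * t'A - UA * (-tp)) / (U - UA)) := by ring
    have e2 : (U₂ * (-t'A) - UA * t₂) / (U₂ - UA) = -((U₂ * t'A - UA * (-t₂)) / (U₂ - UA)) := by ring
    rw [e1, e2]
    exact max_le_max (by linarith) le_rfl
  have hm₁ : 0 ≤ max (2 * t'A + (U * (-t'A) - UA * tp) / (U - UA)) 0 := le_max_right _ _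
  have e₁ : max (2 * t'A + (U * (-t'A) - UA * tp) / (U - UA)) 0 * A / 4 ≤ max (2 * t'A + (U₁ * (-t'A) - UA * t₁) / (U₁ - UA)) 0 * a / 4 :=
    div_le_div_of_nonneg_right ((mul_le_mul_of_nonneg_left ha hm₁).trans (mul_le_mul_of_nonneg_right h₁ ha0)) (by norm_num)
  have e₂ : max (2 * tp - (U * (-t'A) - UA * tp) / (U - UA)) 0 * 1.6211390 / 4 ≤ max (2 * t₂ - (U₂ * (-t'A) - UA * t₂) / (U₂ - UA)) 0 * 1.6211390 / 4 :=
    div_le_div_of_nonneg_right (mul_le_mul_of_nonneg_right h₂ (by norm_num)) (by norm_num)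
  linarith

/-- **Mirror rectangle up to the `t′ = 0` edge**: `(0, t₂] × [U₁, U₂]` (`t₂ ≤ −t′_A`, `U_A < U₁`) with the source hinge evaluated at the corner `(0⁺, U₁)`
(`κ(t, U₁)` decreases in `t`, so `κ(0, U₁) = U₁|t′_A|/(U₁ − U_A)` bounds it) and the target hinge at `(t₂, U₂)`:
`c ≥ w + max(2t′_A + U₁(−t′_A)/(U₁ − U_A), 0)·a/4 + max(2t₂ − κ(t₂, U₂), 0)·1.6211390/4` words every point with `0 < tp ≤ t₂`. [cite: KomaTasaki1994, §1] -/
theorem ObsStiffnessSeqCeilingAt_halfFilling_on_mirrorRectIoc_of_fsumRow_kinematicTarget (Uo : ℝ) (hUA : 0 ≤ UA) (ht'A : t'A < 0) {u r : ℚ}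
    (hrow : SquareTTPrimeCorrOrbitLowerRow t'A UA 1 u r Finset.univ (box 2 7) (-oddMomentObsTT t'A Uo 0))
    (hu : energyDensityTT' 1 t'A UA 1 ≤ ((u : ℚ) : ℝ)) {A : ℝ} (hA0 : 0 ≤ A)
    (hA : ∀ (ω : InfVolFermionState 2) (Ls : ℕ → ℕ) (ψ : ∀ L, Fock (Orb (FermionTorus 2 L))),
      Tendsto Ls atTop atTop →
      (∀ j, IsGroundStateInSector (hubbardTorusTT' (Ls j) 1 t'A UA) (rectN 1 (Ls j)) 0 (ψ (Ls j))) →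
      (∀ j, star (ψ (Ls j)) ⬝ᵥ ψ (Ls j) = 1) → ω.IsTorusLimitOf ψ Ls →
      ω.meanEnergy (hubbardTTPrimeFermionInteraction 0 1 0) 1 ≤ A)
    {w a : ℝ} (hw : -((r : ℚ) : ℝ) ≤ w) (ha : A ≤ a) {t₂ U₁ U₂ : ℝ} (ht₂ : t₂ ≤ -t'A) (hU₁ : UA < U₁) (c : ℚ)
    (hc : w + max (2 * t'A + (U₁ * (-t'A) - UA * 0) / (U₁ - UA)) 0 * a / 4 +
      max (2 * t₂ - (U₂ * (-t'A) - UA * t₂) / (U₂ - UA)) 0 * 1.6211390 / 4 ≤ ((c : ℚ) : ℝ)) :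
    ∀ tp ∈ Set.Ioc (0 : ℝ) t₂, ∀ U ∈ Set.Icc U₁ U₂, ObsStiffnessSeqCeilingAt tp U 1 c := by
  intro tp htp U hU
  have ha0 : 0 ≤ a := hA0.trans ha
  have hd : 0 < U₁ - UA := sub_pos.2 hU₁
  refine ObsStiffnessSeqCeilingAt_halfFilling_on_mirrorRect_of_fsumRow_kinematicTarget Uo hUA ht'A hrow hu hA0 hA hw ha
    htp.1 ht₂ hU₁ c ?_ tp ⟨le_rfl, htp.2⟩ U hU
  have hκ : (U₁ * (-t'A) - UA * tp) / (U₁ - UA) ≤ (U₁ * (-t'A) - UA * 0) / (U₁ - UA) :=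
    div_le_div_of_nonneg_right (by nlinarith [mul_nonneg hUA htp.1.le]) hd.le
  have hm : max (2 * t'A + (U₁ * (-t'A) - UA * tp) / (U₁ - UA)) 0 ≤ max (2 * t'A + (U₁ * (-t'A) - UA * 0) / (U₁ - UA)) 0 :=
    max_le_max (by linarith) le_rfl
  have hm' := mul_le_mul_of_nonneg_right hm ha0
  have e : max (2 * t'A + (U₁ * (-t'A) - UA * tp) / (U₁ - UA)) 0 * a / 4 ≤ max (2 * t'A + (U₁ * (-t'A) - UA * 0) / (U₁ - UA)) 0 * a / 4 :=
    div_le_div_of_nonneg_right hm' (by norm_num)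
  linarith

end MirrorFan

end Summit.Ventures.CertifiedManyBodySolver.Observables

end
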